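import Summits.CriticalPhenomena.PercolationContinuityZ3.Theorems.SahiMasterFamilyFInequalityLABipartite

/-!
# The cut bound for the abstract twisted Marica–Schönheim conjecture (AMS) and for its rank form (LA)

Support file for the master-family `F`-inequality programme (`prim-master-conj` gen 27; `--supports stmt-CriticalPhenomena-4575`;
memo `run/shared/lean/prim/prim-l12/prim-master-conj/POINTWISE.md` §28).  No definition, no `sorry`, standard axioms.

Setting (`TwistedAD.AMSWeighted`, `TwistedAD.LARank`): `S` a complement-closed family of points of the cube, `R` a relation on points
("same label"), `J(S,R) = amsUnions S R = {x ∪ z : x, z ∈ S, ¬R x z, ¬R xᶜ zᶜ}` the admissible unions, `laMatrix S R = (𝟙[wᶜ ⊆ u])_{w ∈ S, u ∈ J(S,R)}`.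
(AMS) asks for `Σ_{x∈S} ω x ≤ 2·Σ_{u∈J(S,R)} ω u`, (LA) for `#S ≤ 2·rank_ℚ laMatrix S R`; both are OPEN, and both are theorems of the tree when
`R` refines an antipodal two-colouring of `S` (`amsIneq_of_twoColouring`, `card_le_two_mul_rank_laMatrix_of_twoColouring`).

NEW here — the **cut bound**, i.e. what one two-colouring gives for an ARBITRARY instance.  Let `f : Finset κ → Bool` be any `R`-invariant
colouring of the points of `S` (`R x z → f x = f z`; for a labelling: any bipartition of the labels) and let
`S_f = {x ∈ S : f xᶜ ≠ f x}` be the points whose antipodal pair CROSSES the cut.  Then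

* `amsUnions_mono`, `rank_laMatrix_mono` — `J(·,R)` and `rank laMatrix · R` are monotone in `S`;
* `sum_crossing_le_two_mul_sum_amsUnions` — `Σ_{x ∈ S_f} ω x ≤ 2·Σ_{u ∈ J(S,R)} ω u` for every complement-invariant FKG weight `ω ≥ 0`;
* `card_crossing_le_two_mul_rank_laMatrix` — `#S_f ≤ 2·rank_ℚ laMatrix S R` (hence `#S_f ≤ 2·#J(S,R)`);
* `sum_class_le_sum_amsUnions`, `card_class_le_rank_laMatrix`, `card_class_le_card_amsUnions` — for an `R`-invariant, antipode-free set of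
  points `g` (e.g. ONE class of a labelling with `¬R x xᶜ`): `Σ_{x ∈ S, g x} ω x ≤ Σ_{u ∈ J(S,R)} ω u`, `#{x ∈ S : g x} ≤ rank laMatrix S R ≤ #J(S,R)`;
* `la_of_dominant_class`, `ams_card_of_dominant_class` — (LA) and the counting (AMS) hold for every instance possessing an `R`-invariant
  antipode-free set of points carrying at least half of `S` ("dominant class").

So (AMS)/(LA) hold up to the MAXCUT DEFECT of the class graph: for a labelling with antipodal edge multiplicities `n_{ℓm}` the open content is
exactly `maxcut < Σ n_{ℓm}`, i.e. the odd cycles of the class graph (first case: three labels, a triangle).  Unlike the witness cases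
(`…LAWitnesses`), the dominant-class case does occur among the instances produced by the strengthened Kleitman conjecture (KC)
(components as labels), where all cross-label pairs are incomparable and bottom witnesses never exist (memo §28 (G4)).

HONEST FRAMING: partial results toward OPEN conjectures of this programme; nothing here is a published theorem. [this work]
-/

namespace Summit.CriticalPhenomena.PercolationContinuityZ3.Theorems

namespace TwistedAD

open Finset Matrix
open scoped FinsetFamily Classical

variable {κ : Type*} [Fintype κ] [DecidableEq κ]

/-! ### Monotonicity in `S` -/

/-- The admissible unions are monotone in the family: `S' ⊆ S ⟹ J(S',R) ⊆ J(S,R)`. [this work] -/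
theorem amsUnions_mono {S' S : Finset (Finset κ)} (h : S' ⊆ S) (R : Finset κ → Finset κ → Prop) :
    amsUnions S' R ⊆ amsUnions S R := by
  intro u hu
  unfold amsUnions at hu ⊢
  rw [mem_image] at hu ⊢
  obtain ⟨p, hp, hpu⟩ := hu
  rw [mem_filter, mem_product] at hp
  exact ⟨p, mem_filter.2 ⟨mem_product.2 ⟨h hp.1.1, h hp.1.2⟩, hp.2⟩, hpu⟩

/-- The rank of the co-containment matrix is monotone in the family: `S' ⊆ S ⟹ rank laMatrix S' R ≤ rank laMatrix S R`
(`laMatrix S' R` is a submatrix of `laMatrix S R`). [this work] -/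
theorem rank_laMatrix_mono {S' S : Finset (Finset κ)} (h : S' ⊆ S) (R : Finset κ → Finset κ → Prop) :
    (laMatrix S' R).rank ≤ (laMatrix S R).rank := by
  let r : ↥S' → ↥S := fun w => ⟨(w : Finset κ), h w.2⟩
  let c : ↥(amsUnions S' R) → ↥(amsUnions S R) := fun u => ⟨(u : Finset κ), amsUnions_mono h R u.2⟩
  have hsub : (laMatrix S R).submatrix r c = laMatrix S' R := by
    ext w u
    simp only [laMatrix, Matrix.submatrix_apply, Matrix.of_apply, r, c]
  rw [← hsub]
  exact Matrix.rank_submatrix_le _ _ _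

/-! ### The crossing family of a colouring -/

/-- For complement-closed `S`, the family of points of `S` whose antipodal pair crosses the colouring `f` is complement-closed. [this work] -/
theorem compl_mem_crossing {S : Finset (Finset κ)} (hScl : ∀ x ∈ S, xᶜ ∈ S) (f : Finset κ → Bool)
    {x : Finset κ} (hx : x ∈ S.filter (fun x => f xᶜ ≠ f x)) : xᶜ ∈ S.filter (fun x => f xᶜ ≠ f x) := by
  rw [mem_filter] at hx ⊢
  refine ⟨hScl x hx.1, ?_⟩
  rw [compl_compl]
  exact fun h => hx.2 h.symm

/-- **Cut bound, weighted form.**  Let `ω ≥ 0` be complement-invariant with the FKG lattice condition, `S` complement-closed, and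
`f : Finset κ → Bool` an `R`-invariant colouring of `S` (`R x z → f x = f z` on `S`).  Then the points of `S` whose antipodal pair crosses
the cut weigh at most twice the admissible unions: `Σ_{x ∈ S, f xᶜ ≠ f x} ω x ≤ 2·Σ_{u ∈ J(S,R)} ω u`.
Proof: the crossing family `S_f` is complement-closed and `R` refines the antipodal two-colouring `f` on it, so `amsIneq_of_twoColouring`
gives `ω(S_f) ≤ 2ω(J(S_f,R)) ≤ 2ω(J(S,R))`. [this work] -/
theorem sum_crossing_le_two_mul_sum_amsUnions (ω : Finset κ → ℝ) (hω₀ : ∀ s, 0 ≤ ω s)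
    (hω : ∀ s t, ω s * ω t ≤ ω (s ⊓ t) * ω (s ⊔ t)) (hsym : ∀ s, ω sᶜ = ω s)
    (S : Finset (Finset κ)) (R : Finset κ → Finset κ → Prop) (hScl : ∀ x ∈ S, xᶜ ∈ S)
    (f : Finset κ → Bool) (hRf : ∀ x ∈ S, ∀ z ∈ S, R x z → f x = f z) :
    ∑ x ∈ S.filter (fun x => f xᶜ ≠ f x), ω x ≤ 2 * ∑ u ∈ amsUnions S R, ω u := by
  set S' := S.filter (fun x => f xᶜ ≠ f x) with hS'
  have hS'cl : ∀ x ∈ S', xᶜ ∈ S' := fun x hx => compl_mem_crossing hScl f hx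
  have hf' : ∀ x ∈ S', f xᶜ ≠ f x := fun x hx => (mem_filter.1 hx).2
  have hRf' : ∀ x ∈ S', ∀ z ∈ S', R x z → f x = f z :=
    fun x hx z hz hxz => hRf x (mem_filter.1 hx).1 z (mem_filter.1 hz).1 hxz
  have key := amsIneq_of_twoColouring ω hω₀ hω hsym S' R hS'cl f hf' hRf'
  have hmono : ∑ u ∈ amsUnions S' R, ω u ≤ ∑ u ∈ amsUnions S R, ω u :=
    sum_le_sum_of_subset_of_nonneg (amsUnions_mono (filter_subset _ S) R) fun u _ _ => hω₀ u
  have key' : ∑ x ∈ S', ω x ≤ 2 * ∑ u ∈ amsUnions S' R, ω u := key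
  linarith

/-- **Cut bound, rank form.**  For complement-closed `S` and an `R`-invariant colouring `f` of `S`:
`#{x ∈ S : f xᶜ ≠ f x} ≤ 2·rank_ℚ laMatrix S R` ((LA) holds up to the maxcut defect). [this work] -/
theorem card_crossing_le_two_mul_rank_laMatrix (S : Finset (Finset κ)) (R : Finset κ → Finset κ → Prop)
    (hScl : ∀ x ∈ S, xᶜ ∈ S) (f : Finset κ → Bool) (hRf : ∀ x ∈ S, ∀ z ∈ S, R x z → f x = f z) :
    (S.filter (fun x => f xᶜ ≠ f x)).card ≤ 2 * (laMatrix S R).rank := by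
  set S' := S.filter (fun x => f xᶜ ≠ f x) with hS'
  have hS'cl : ∀ x ∈ S', xᶜ ∈ S' := fun x hx => compl_mem_crossing hScl f hx
  have hf' : ∀ x ∈ S', f xᶜ ≠ f x := fun x hx => (mem_filter.1 hx).2
  have hRf' : ∀ x ∈ S', ∀ z ∈ S', R x z → f x = f z :=
    fun x hx z hz hxz => hRf x (mem_filter.1 hx).1 z (mem_filter.1 hz).1 hxz
  have key : S'.card ≤ 2 * (laMatrix S' R).rank := card_le_two_mul_rank_laMatrix_of_twoColouring S' R hS'cl f hf' hRf'
  have hmono : (laMatrix S' R).rank ≤ (laMatrix S R).rank := rank_laMatrix_mono (filter_subset _ S) R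
  omega

/-- Cut bound, counting form: `#{x ∈ S : f xᶜ ≠ f x} ≤ 2·#J(S,R)`. [this work] -/
theorem card_crossing_le_two_mul_card_amsUnions (S : Finset (Finset κ)) (R : Finset κ → Finset κ → Prop)
    (hScl : ∀ x ∈ S, xᶜ ∈ S) (f : Finset κ → Bool) (hRf : ∀ x ∈ S, ∀ z ∈ S, R x z → f x = f z) :
    (S.filter (fun x => f xᶜ ≠ f x)).card ≤ 2 * (amsUnions S R).card := by
  have h1 := card_crossing_le_two_mul_rank_laMatrix S R hScl f hRf
  have h2 : (laMatrix S R).rank ≤ Fintype.card ↥(amsUnions S R) := Matrix.rank_le_card_width _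
  rw [Fintype.card_coe] at h2
  exact h1.trans (Nat.mul_le_mul_left 2 h2)

/-! ### One antipode-free union of classes -/

/-- If `g` marks an antipode-free set of points of `S` (`g x = true → g xᶜ = false` on `S`), then both `{x ∈ S : g x}` and its family of
complements lie in the crossing family of the colouring `g`, and they are disjoint. [this work] -/
theorem filter_union_compls_subset_crossing (S : Finset (Finset κ)) (hScl : ∀ x ∈ S, xᶜ ∈ S) (g : Finset κ → Bool)
    (hanti : ∀ x ∈ S, g x = true → g xᶜ = false) :
    S.filter (fun x => g x = true) ∪ (S.filter (fun x => g x = true))ᶜˢ ⊆ S.filter (fun x => g xᶜ ≠ g x) ∧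
      Disjoint (S.filter (fun x => g x = true)) (S.filter (fun x => g x = true))ᶜˢ := by
  constructor
  · intro x hx
    rcases mem_union.1 hx with h | h
    · obtain ⟨hxS, hgx⟩ := mem_filter.1 h
      refine mem_filter.2 ⟨hxS, ?_⟩
      rw [hgx, hanti x hxS hgx]
      exact Bool.false_ne_true
    · rw [mem_compls, mem_filter] at h
      obtain ⟨hxcS, hgxc⟩ := h
      have hxS : x ∈ S := by simpa using hScl xᶜ hxcS
      refine mem_filter.2 ⟨hxS, ?_⟩
      have hgx : g x = false := by simpa using hanti xᶜ hxcS hgxc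
      rw [hgxc, hgx]
      exact Bool.false_ne_true.symm
  · rw [disjoint_left]
    intro x hx hxc
    obtain ⟨hxS, hgx⟩ := mem_filter.1 hx
    rw [mem_compls, mem_filter] at hxc
    have := hanti x hxS hgx
    rw [hxc.2] at this
    exact Bool.false_ne_true this.symm

/-- **Class bound, weighted form.**  `ω ≥ 0` complement-invariant FKG, `S` complement-closed, `g` an `R`-invariant antipode-free set of points
of `S` (e.g. one class of a labelling with `¬R x xᶜ`, or any antipode-free union of classes).  Then `Σ_{x ∈ S, g x} ω x ≤ Σ_{u ∈ J(S,R)} ω u`.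
[this work] -/
theorem sum_class_le_sum_amsUnions (ω : Finset κ → ℝ) (hω₀ : ∀ s, 0 ≤ ω s)
    (hω : ∀ s t, ω s * ω t ≤ ω (s ⊓ t) * ω (s ⊔ t)) (hsym : ∀ s, ω sᶜ = ω s)
    (S : Finset (Finset κ)) (R : Finset κ → Finset κ → Prop) (hScl : ∀ x ∈ S, xᶜ ∈ S)
    (g : Finset κ → Bool) (hRg : ∀ x ∈ S, ∀ z ∈ S, R x z → g x = g z) (hanti : ∀ x ∈ S, g x = true → g xᶜ = false) :
    ∑ x ∈ S.filter (fun x => g x = true), ω x ≤ ∑ u ∈ amsUnions S R, ω u := by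
  set P := S.filter (fun x => g x = true) with hP
  obtain ⟨hsub, hdisj⟩ := filter_union_compls_subset_crossing S hScl g hanti
  have h1 : ∑ x ∈ P ∪ Pᶜˢ, ω x ≤ ∑ x ∈ S.filter (fun x => g xᶜ ≠ g x), ω x :=
    sum_le_sum_of_subset_of_nonneg hsub fun x _ _ => hω₀ x
  have h2 : ∑ x ∈ P ∪ Pᶜˢ, ω x = ∑ x ∈ P, ω x + ∑ x ∈ Pᶜˢ, ω x := sum_union hdisj
  have h3 : ∑ x ∈ Pᶜˢ, ω x = ∑ x ∈ P, ω x := sum_compls_eq ω hsym P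
  have h4 := sum_crossing_le_two_mul_sum_amsUnions ω hω₀ hω hsym S R hScl g hRg
  linarith

/-- **Class bound, rank form**: for complement-closed `S` and an `R`-invariant antipode-free set of points `g` of `S`,
`#{x ∈ S : g x} ≤ rank_ℚ laMatrix S R`. [this work] -/
theorem card_class_le_rank_laMatrix (S : Finset (Finset κ)) (R : Finset κ → Finset κ → Prop) (hScl : ∀ x ∈ S, xᶜ ∈ S)
    (g : Finset κ → Bool) (hRg : ∀ x ∈ S, ∀ z ∈ S, R x z → g x = g z) (hanti : ∀ x ∈ S, g x = true → g xᶜ = false) :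
    (S.filter (fun x => g x = true)).card ≤ (laMatrix S R).rank := by
  set P := S.filter (fun x => g x = true) with hP
  obtain ⟨hsub, hdisj⟩ := filter_union_compls_subset_crossing S hScl g hanti
  have h1 : (P ∪ Pᶜˢ).card ≤ (S.filter (fun x => g xᶜ ≠ g x)).card := card_le_card hsub
  have h2 : (P ∪ Pᶜˢ).card = P.card + Pᶜˢ.card := card_union_of_disjoint hdisj
  have h3 : Pᶜˢ.card = P.card := card_compls _
  have h4 := card_crossing_le_two_mul_rank_laMatrix S R hScl g hRg
  omega

/-- **Class bound, counting form**: `#{x ∈ S : g x} ≤ #J(S,R)` for an `R`-invariant antipode-free `g`; for a labelling: the number of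
admissible unions is at least the size of the largest class. [this work] -/
theorem card_class_le_card_amsUnions (S : Finset (Finset κ)) (R : Finset κ → Finset κ → Prop) (hScl : ∀ x ∈ S, xᶜ ∈ S)
    (g : Finset κ → Bool) (hRg : ∀ x ∈ S, ∀ z ∈ S, R x z → g x = g z) (hanti : ∀ x ∈ S, g x = true → g xᶜ = false) :
    (S.filter (fun x => g x = true)).card ≤ (amsUnions S R).card := by
  have h1 := card_class_le_rank_laMatrix S R hScl g hRg hanti
  have h2 : (laMatrix S R).rank ≤ Fintype.card ↥(amsUnions S R) := Matrix.rank_le_card_width _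
  rw [Fintype.card_coe] at h2
  exact h1.trans h2

/-- **(LA) for instances with a dominant class.**  If some `R`-invariant antipode-free set of points carries at least half of `S`, the
conjectured inequality `#S ≤ 2·rank_ℚ laMatrix S R` holds for `(S,R)`. [this work] -/
theorem la_of_dominant_class (S : Finset (Finset κ)) (R : Finset κ → Finset κ → Prop) (hScl : ∀ x ∈ S, xᶜ ∈ S)
    (g : Finset κ → Bool) (hRg : ∀ x ∈ S, ∀ z ∈ S, R x z → g x = g z) (hanti : ∀ x ∈ S, g x = true → g xᶜ = false)
    (hdom : S.card ≤ 2 * (S.filter (fun x => g x = true)).card) :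
    S.card ≤ 2 * (laMatrix S R).rank :=
  hdom.trans (Nat.mul_le_mul_left 2 (card_class_le_rank_laMatrix S R hScl g hRg hanti))

/-- **Counting (AMS) for instances with a dominant class**: `#S ≤ 2·#J(S,R)`. [this work] -/
theorem ams_card_of_dominant_class (S : Finset (Finset κ)) (R : Finset κ → Finset κ → Prop) (hScl : ∀ x ∈ S, xᶜ ∈ S)
    (g : Finset κ → Bool) (hRg : ∀ x ∈ S, ∀ z ∈ S, R x z → g x = g z) (hanti : ∀ x ∈ S, g x = true → g xᶜ = false)
    (hdom : S.card ≤ 2 * (S.filter (fun x => g x = true)).card) :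
    S.card ≤ 2 * (amsUnions S R).card :=
  hdom.trans (Nat.mul_le_mul_left 2 (card_class_le_card_amsUnions S R hScl g hRg hanti))

end TwistedAD

end Summit.CriticalPhenomena.PercolationContinuityZ3.Theorems
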